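import Literature.MathematicalPhysics.QuantumLattice.HubbardLSMFillingAssembly
import Literature.MathematicalPhysics.QuantumLattice.QuasiAdiabaticGenerator
import HarnessLib

/-!
# Local charge fluctuations of the gapped Hubbard torus (BBDF Proposition 2.4, Assumption (iv))

Bachmann–Bols–De Roeck–Fraas, *A many-body index for quantum charge transport*, Comm. Math. Phys.
**375** (2019) 1249 (BBDF), Proposition 2.4: for the unique gapped ground state `Ω` of a
finite-range charge-conserving Hamiltonian, `[Q, H] = J₋ + J₊` splits into two boundary currents,
`K̃± = i𝓘(J±)` (the quasi-adiabatic map `𝓘`) make `Ω` an EXACT eigenvector of `Q - K̃₋ - K̃₊`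
("`[Q,P] - i[𝓘([Q,H]),P] = 0`"), and by the Lieb–Robinson bound the `K̃±` have strictly local
approximants `K± ∈ 𝒜_{∂±^{L/16}}`, `K̃± = K± + O(L^{-∞})`, `‖K±‖ = O(L^d)` — Assumption (iv).
This file PROVES this for the grand-canonical Hubbard Hamiltonian on the torus `ℤ_L^d` and the
charges `n_{xσ}`, in exactly the quantitative form consumed by
`bbdf2019_lsm_filling_of_inputs` (`HubbardLSMFillingAssembly.lean`), and concludes the named fact
`bbdf2019_lsm_filling_hubbardTorus` MODULO THE CLUSTERING INPUT (Assumption (v)):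

* `norm_commutator_evolution_far_le` — the Lieb–Robinson input: for an even observable `J` of the
  window slab `{b-1 ≤ x_{i₀} ≤ b}` and `A = H - H_box` (terms not inside `{b-w ≤ x_{i₀} ≤ b+w-1}`),
  `‖[τ_s(A), J]‖ ≤ 4J N_T ‖A‖‖J‖ T e^{κT-(w-2)}` for `|s| ≤ T` (the tree's fermionic bound
  `fermion_lieb_robinson_hamiltonianWith` in the `x₁`-geometry of `CoordinateSlabs.clevel`, both time
  directions);
* `norm_qaGenerator_sub_local_le`, `dressing_at_boundary` — locality of the dressing
  `K = i𝓘^{H_box}(J)`: Hermitian, even, supported in the box, `‖K‖ ≤ (‖W₁‖₁/g)‖J‖`,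
  `‖i𝓘^H(J) - K‖ ≤ ηT‖W₁‖₁/g + 4‖J‖C_k/(g(1+gT)^{k+1})` (`QuasiAdiabaticGenerator`);
* `local_fluctuations_core` — Prop. 2.4 (iv) at one volume: the crossing terms of the half-space
  slab split into the two windows (`CoordinateSlabs.crossing_zrange_subset`), exactness from
  `qaGenerator_intertwines`, and `‖(Q_Γ - K₋ - K₊)ψ - qψ‖ ≤ ‖K̃₋ - K₋‖ + ‖K̃₊ - K₊‖`;
* `local_fluctuations_hubbardTorus` — the uniform `O(L^{-∞})` form (`w = L/16`, `h = L/2`,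
  `T = (w-2)/(2κ+1)`, `k = k'+d`; constants depending on `d, t, U, μ, g, k'` only);
* `bbdf2019_lsm_filling_of_clustering` — **the named fact from clustering alone**.

Design note (instances, cf. `HubbardTorusCharges`, `HubbardLSMFillingAssembly`): inside
`section Analysis` the `DecidableEq` instances of the sites and orbitals of the torus are pinned
(`local instance`) to the ones derived from the linear order, so that every operator-norm and
spectral-gap expression of this file's lemmas is syntactically the one carried by the generic
CAR-algebra / Lieb–Robinson / quasi-adiabatic lemmas; the final statements (`section Unpinned`) use
the ambient instances and are transported with `convert` (the two instances are equal by
`Subsingleton.elim`). No mathematical content depends on this.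

## References

* S. Bachmann, A. Bols, W. De Roeck, M. Fraas, Comm. Math. Phys. **375** (2019) 1249–1272,
  arXiv:1810.07351: §2.4 (Proposition 2.4 and its proof), §2.5, §3.2. [BachmannEtAl2019]
* S. Bachmann, S. Michalakis, B. Nachtergaele, R. Sims, Comm. Math. Phys. **309** (2012) 835,
  Lemma 4.7 (locality of `𝓘`), as formalised in `QuasiAdiabaticGenerator.lean`.
* M. B. Hastings, T. Koma, Comm. Math. Phys. **265** (2006) 781, App. A (fermionic Lieb–Robinson
  bound), as formalised in `FermionLiebRobinson.lean`.
* The tree: `HubbardLSMFillingAssembly` (`zIco`, `bbdf2019_lsm_filling_of_inputs`),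
  `HubbardTorusCharges` (`setCharge`, `slab`, `localHubbard`, `crossing`,
  `setCharge_commutator_hamiltonianWith`), `CoordinateSlabs` (`clevel`, `zrange`,
  `crossing_zrange_subset`), `FermionLiebRobinson`, `QuasiAdiabaticGenerator`, `LocalDynamics`.
-/

noncomputable section

namespace Literature.MathematicalPhysics.QuantumLattice

open Matrix Complex Finset HubbardWave0 MeasureTheory
open scoped Matrix.Norms.L2Operator ComplexOrder Real

/-! ### Generic helpers -/

section Generic

variable {n : Type*} [Fintype n] [DecidableEq n]

/-- The quasi-adiabatic generator is additive in the observable. [folklore] -/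
theorem qaGenerator_add {H : Matrix n n ℂ} (hH : H.IsHermitian) (γ : ℝ) (A B : Matrix n n ℂ) :
    qaGenerator γ H (A + B) = qaGenerator γ H A + qaGenerator γ H B := by
  by_cases hγ : γ = 0
  · subst hγ; simp [qaGenerator_zero_left]
  unfold qaGenerator
  rw [← integral_add (integrable_qaWeight_smul_heisenbergEvolution hH hγ A)
    (integrable_qaWeight_smul_heisenbergEvolution hH hγ B)]
  refine congrArg (fun F : ℝ → Matrix n n ℂ => ∫ t, F t) (funext fun t => ?_)
  rw [← smul_add]
  congr 1
  simp [heisenbergEvolution, Matrix.mul_add, Matrix.add_mul]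

/-- `‖i • X‖ = ‖X‖`. [folklore] -/
theorem norm_I_smul (X : Matrix n n ℂ) : ‖(I : ℂ) • X‖ = ‖X‖ := by
  rw [norm_smul, Complex.norm_I, one_mul]

/-- Commutators with a negative-time evolution: `‖[τ_{-s}(A), B]‖ = ‖[τ_s(B), A]‖`. [folklore] -/
theorem norm_commutator_heisenbergEvolution_neg' {H : Matrix n n ℂ} (hH : H.IsHermitian) (s : ℝ)
    (A B : Matrix n n ℂ) :
    ‖heisenbergEvolution H (-s) A * B - B * heisenbergEvolution H (-s) A‖ =
      ‖heisenbergEvolution H s B * A - A * heisenbergEvolution H s B‖ := by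
  rw [← norm_neg, neg_sub]
  exact norm_commutator_heisenbergEvolution_neg hH s B A

omit [DecidableEq n] in
/-- A sum of pairwise-commuting-with-`B` terms commutes with `B`. [folklore] -/
theorem finset_sum_mul_sub_mul_finset_sum_eq_zero {ι : Type*} (s : Finset ι) (f : ι → Matrix n n ℂ)
    (B : Matrix n n ℂ) (h : ∀ i ∈ s, Commute (f i) B) :
    (∑ i ∈ s, f i) * B - B * ∑ i ∈ s, f i = 0 :=
  sub_eq_zero.2 (Commute.sum_left s f B h).eq

end Generic

/-! ### Counting the local terms of the Hubbard Hamiltonian -/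

section Counting

variable {Λ : Type*} [LinearOrder Λ] [Fintype Λ] (G : SimpleGraph Λ) [DecidableRel G.Adj]

/-- **The number of local terms**: on a graph of maximal degree `≤ Δ`, `H(t,U) - μN` has at most
`(Δ + 1)|Λ|` local terms (ordered bonds and sites). [folklore] -/
theorem card_hubbardIdx_le {Δ : ℕ} (hΔ : ∀ x : Λ, (Finset.univ.filter fun y => G.Adj x y).card ≤ Δ) :
    Fintype.card (HubbardIdx G) ≤ (Δ + 1) * Fintype.card Λ := by
  classical
  rw [Fintype.card_sum, add_mul, one_mul]
  refine Nat.add_le_add_right ?_ _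
  -- bonds: `|{(x,y) : x ∼ y}| = Σ_x deg x ≤ Δ |Λ|`
  have h1 : Fintype.card {p : Λ × Λ // G.Adj p.1 p.2} =
      (Finset.univ.filter fun p : Λ × Λ => G.Adj p.1 p.2).card := Fintype.card_subtype _
  rw [h1]
  have h2 : (Finset.univ.filter fun p : Λ × Λ => G.Adj p.1 p.2) =
      Finset.univ.biUnion fun x : Λ => (Finset.univ.filter fun y => G.Adj x y).image fun y => (x, y) := by
    ext ⟨x, y⟩
    simp
  rw [h2]
  calc (Finset.univ.biUnion fun x : Λ => (Finset.univ.filter fun y => G.Adj x y).image fun y => (x, y)).card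
      ≤ ∑ x : Λ, ((Finset.univ.filter fun y => G.Adj x y).image fun y => (x, y)).card := Finset.card_biUnion_le
    _ ≤ ∑ _x : Λ, Δ := Finset.sum_le_sum fun x _ => Finset.card_image_le.trans (hΔ x)
    _ = Δ * Fintype.card Λ := by rw [Finset.sum_const, Finset.card_univ, smul_eq_mul, mul_comm]

omit [DecidableRel G.Adj] in
/-- Norm of a sum of local terms: `‖Σ_{Z ∈ S} Φ_Z‖ ≤ |S| (2|t| + |U| + 2|μ|)`. [folklore] -/
theorem norm_sum_hubbardTermOp_le (t U μ : ℝ) (S : Finset (HubbardIdx G)) :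
    ‖∑ Z ∈ S, hubbardTermOp G t U μ Z‖ ≤ S.card * (2 * |t| + |U| + 2 * |μ|) := by
  calc ‖∑ Z ∈ S, hubbardTermOp G t U μ Z‖ ≤ ∑ Z ∈ S, ‖hubbardTermOp G t U μ Z‖ := norm_sum_le _ _
    _ ≤ ∑ _Z ∈ S, (2 * |t| + |U| + 2 * |μ|) := Finset.sum_le_sum fun Z _ => norm_hubbardTermOp_le G t U μ Z
    _ = S.card * (2 * |t| + |U| + 2 * |μ|) := by rw [Finset.sum_const, nsmul_eq_mul]

omit [DecidableRel G.Adj] in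
/-- Norm of a sum of boundary commutators: `‖Σ_{Z ∈ S} [Q^σ_X, Φ_Z]‖ ≤ 4|S| (2|t| + |U| + 2|μ|)`.
[folklore] -/
theorem norm_sum_setCharge_commutator_le (t U μ : ℝ) (σ : Fin 2) (X : Finset Λ) (S : Finset (HubbardIdx G)) :
    ‖∑ Z ∈ S, (setCharge σ X * hubbardTermOp G t U μ Z - hubbardTermOp G t U μ Z * setCharge σ X)‖ ≤
      S.card * (4 * (2 * |t| + |U| + 2 * |μ|)) := by
  calc _ ≤ ∑ Z ∈ S, ‖setCharge σ X * hubbardTermOp G t U μ Z - hubbardTermOp G t U μ Z * setCharge σ X‖ :=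
        norm_sum_le _ _
    _ ≤ ∑ _Z ∈ S, 4 * (2 * |t| + |U| + 2 * |μ|) :=
        Finset.sum_le_sum fun Z _ => norm_setCharge_commutator_hubbardTermOp_le G t U μ σ X Z
    _ = S.card * (4 * (2 * |t| + |U| + 2 * |μ|)) := by rw [Finset.sum_const, nsmul_eq_mul]

omit [DecidableRel G.Adj] in
/-- A sum of boundary commutators is anti-Hermitian. [folklore] -/
theorem conjTranspose_sum_setCharge_commutator (t U μ : ℝ) (σ : Fin 2) (X : Finset Λ) (S : Finset (HubbardIdx G)) :
    (∑ Z ∈ S, (setCharge σ X * hubbardTermOp G t U μ Z - hubbardTermOp G t U μ Z * setCharge σ X))ᴴ =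
      -∑ Z ∈ S, (setCharge σ X * hubbardTermOp G t U μ Z - hubbardTermOp G t U μ Z * setCharge σ X) := by
  rw [conjTranspose_sum, ← Finset.sum_neg_distrib]
  exact Finset.sum_congr rfl fun Z _ => conjTranspose_setCharge_commutator_hubbardTermOp G t U μ σ X Z

omit [DecidableRel G.Adj] in
/-- A sum of boundary commutators over terms supported in `W` is an even element of the CAR
algebra of `W`. [folklore] -/
theorem sum_setCharge_commutator_mem (t U μ : ℝ) (σ : Fin 2) (X W : Finset Λ) (S : Finset (HubbardIdx G))
    (hS : ∀ Z ∈ S, hubbardTermSupp G Z ⊆ W) :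
    ∑ Z ∈ S, (setCharge σ X * hubbardTermOp G t U μ Z - hubbardTermOp G t U μ Z * setCharge σ X) ∈
      carEvenSubalgebra (orbSet W) :=
  Subalgebra.sum_mem _ fun Z hZ =>
    carEvenSubalgebra_mono (orbSet_mono (hS Z hZ)) (setCharge_commutator_hubbardTermOp_mem G t U μ σ X Z)

/-- The terms not supported in `B` all lie in the CAR algebra of any `X` containing their
supports. [folklore] -/
theorem hamiltonianWith_sub_localHubbard_mem (t U μ : ℝ) (B X : Finset Λ)
    (hX : ∀ Z : HubbardIdx G, ¬ hubbardTermSupp G Z ⊆ B → hubbardTermSupp G Z ⊆ X) :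
    hamiltonianWith G t U μ - localHubbard G t U μ B ∈ carEvenSubalgebra (orbSet X) := by
  rw [hamiltonianWith_sub_localHubbard]
  refine Subalgebra.sum_mem _ fun Z hZ => ?_
  rw [Finset.mem_filter] at hZ
  exact carEvenSubalgebra_mono (orbSet_mono (hX Z hZ.2)) (hubbardTermOp_mem_carEvenSubalgebra G t U μ Z)

/-- `‖H - H_B‖ ≤ (#terms) (2|t| + |U| + 2|μ|)`. [folklore] -/
theorem norm_hamiltonianWith_sub_localHubbard_le (t U μ : ℝ) (B : Finset Λ) :
    ‖hamiltonianWith G t U μ - localHubbard G t U μ B‖ ≤ Fintype.card (HubbardIdx G) * (2 * |t| + |U| + 2 * |μ|) := by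
  rw [hamiltonianWith_sub_localHubbard]
  refine (norm_sum_hubbardTermOp_le G t U μ _).trans ?_
  have h : ((Finset.univ.filter fun Z : HubbardIdx G => ¬ hubbardTermSupp G Z ⊆ B).card : ℝ) ≤
      Fintype.card (HubbardIdx G) := by exact_mod_cast Finset.card_le_univ _
  exact mul_le_mul_of_nonneg_right h (by positivity)

end Counting

/-! ### Window geometry on the torus around a boundary hyperplane `x_{i₀} = b` -/

section Geometry

open FermionTorus

variable {d L : ℕ}

/-- Windows are `L`-periodic in their endpoints. [folklore] -/
theorem zIco_add_period (a b : ℤ) : zIco L (a + L) (b + L) = zIco L a b := by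
  rw [zIco, zIco, ← Finset.image_add_right_Ico, Finset.image_image]
  congr 1
  funext x
  simp

/-- A window of length `L` is all of `ℤ/L`. [folklore] -/
theorem zIco_eq_univ_of_length [NeZero L] (a : ℤ) : zIco L a (a + L) = Finset.univ := by
  refine Finset.eq_univ_of_forall fun z => ?_
  have hL : (0 : ℤ) < L := by exact_mod_cast NeZero.pos L
  -- the representative of `z` in `[a, a + L)`
  set x : ℤ := a + (((z.val : ℤ) - a) % (L : ℤ)) with hx
  have h0 : 0 ≤ ((z.val : ℤ) - a) % (L : ℤ) := Int.emod_nonneg _ hL.ne'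
  have h1 : ((z.val : ℤ) - a) % (L : ℤ) < L := Int.emod_lt_of_pos _ hL
  refine mem_zIco.2 ⟨x, by linarith, by linarith, ?_⟩
  have hcast : ((x : ℤ) : ZMod L) = ((z.val : ℤ) : ZMod L) := by
    rw [ZMod.intCast_eq_intCast_iff_dvd_sub, hx]
    refine ⟨((z.val : ℤ) - a) / (L : ℤ), ?_⟩
    have := Int.emod_def ((z.val : ℤ) - a) (L : ℤ)
    linarith
  rw [hcast, Int.cast_natCast, ZMod.natCast_zmod_val]

/-- The complement of a window inside a period is the adjacent window. [folklore] -/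
theorem mem_zIco_of_not_mem [NeZero L] {a b : ℤ} (hab : a ≤ b) (hbL : b ≤ a + L) {z : ZMod L}
    (hz : z ∉ zIco L a b) : z ∈ zIco L b (a + L) := by
  have hu : z ∈ zIco L a (a + L) := by rw [zIco_eq_univ_of_length]; exact Finset.mem_univ _
  rw [← zIco_union_zIco hab hbL, Finset.mem_union] at hu
  exact hu.resolve_left hz

variable [NeZero L]

/-- Every coordinate value is attained (the torus has a site in every hyperplane; needs `d ≥ 1`,
witnessed by `i₀`). [folklore] -/
theorem exists_coordZ_eq (i₀ : Fin d) (c : ZMod L) : ∃ x : FermionTorus d L, coordZ i₀ x = c := by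
  refine ⟨toLex fun i => ⟨c.val, ZMod.val_lt c⟩, ?_⟩
  change (((ofLex (toLex fun i : Fin d => (⟨c.val, ZMod.val_lt c⟩ : Fin L))) i₀ : ℕ) : ZMod L) = c
  rw [ofLex_toLex]
  exact ZMod.natCast_zmod_val c

/-- Slabs over nonempty coordinate sets are nonempty. [folklore] -/
theorem slab_nonempty (i₀ : Fin d) {S : Finset (ZMod L)} (hS : S.Nonempty) :
    (slab i₀ S : Finset (FermionTorus d L)).Nonempty := by
  obtain ⟨c, hc⟩ := hS
  obtain ⟨x, hx⟩ := exists_coordZ_eq (L := L) i₀ c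
  exact ⟨x, mem_slab.2 (hx ▸ hc)⟩

omit [NeZero L] in
/-- Windows of positive length are nonempty. [folklore] -/
theorem zIco_nonempty {a b : ℤ} (h : a < b) : (zIco L a b).Nonempty :=
  ⟨(a : ZMod L), intCast_mem_zIco le_rfl h⟩

omit [NeZero L] in
/-- **The support of a local term lies within one step of any of its sites**: if a site of the
term `Z` has coordinate `c`, then all sites of `Z` have coordinates in `[c-1, c+1]`. [folklore] -/
theorem hubbardTermSupp_subset_slab {i₀ : Fin d} {Z : HubbardIdx (fermionTorusGraph d L)} {y : FermionTorus d L}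
    (hy : y ∈ hubbardTermSupp (fermionTorusGraph d L) Z) {c : ℤ} (hc : coordZ i₀ y = (c : ZMod L)) :
    hubbardTermSupp (fermionTorusGraph d L) Z ⊆ slab i₀ (zIco L (c - 1) (c + 2)) := by
  -- every site of `Z` is `y` or adjacent to `y`
  have key : ∀ x ∈ hubbardTermSupp (fermionTorusGraph d L) Z, x = y ∨ (fermionTorusGraph d L).Adj x y :=
    fun x hx => eq_or_adj_of_mem_hubbardTermSupp (fermionTorusGraph d L) hx hy
  intro x hx
  rw [mem_slab]
  rcases key x hx with rfl | hadj
  · rw [hc]; exact intCast_mem_zIco (by linarith) (by linarith)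
  · rcases coordZ_rel_of_adj i₀ hadj with e | e | e
    · rw [e, hc]; exact intCast_mem_zIco (by linarith) (by linarith)
    · -- `coordZ y = coordZ x + 1`
      have : coordZ i₀ x = ((c - 1 : ℤ) : ZMod L) := by
        rw [hc] at e; push_cast; linear_combination -e
      rw [this]; exact intCast_mem_zIco (by linarith) (by linarith)
    · -- `coordZ x = coordZ y + 1`
      have : coordZ i₀ x = ((c + 1 : ℤ) : ZMod L) := by rw [e, hc]; push_cast; ring
      rw [this]; exact intCast_mem_zIco (by linarith) (by linarith)

omit [NeZero L] in
/-- If a site of `Z` has its coordinate in the window `[a, e)`, then `supp Z ⊆ slab [a-1, e+1)`.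
[folklore] -/
theorem hubbardTermSupp_subset_slab_of_mem {i₀ : Fin d} {Z : HubbardIdx (fermionTorusGraph d L)}
    {y : FermionTorus d L} (hy : y ∈ hubbardTermSupp (fermionTorusGraph d L) Z) {a e : ℤ}
    (hc : coordZ i₀ y ∈ zIco L a e) :
    hubbardTermSupp (fermionTorusGraph d L) Z ⊆ slab i₀ (zIco L (a - 1) (e + 1)) := by
  obtain ⟨c, hac, hce, hcy⟩ := mem_zIco.1 hc
  exact (hubbardTermSupp_subset_slab hy hcy.symm).trans (slab_mono i₀ (zIco_subset_zIco (by linarith) (by linarith)))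

/-- **Terms not supported in the box `[b-w, b+w-1]` are supported in the far region
`[b+w-1, b+L-w]`** (`1 ≤ w`, `2w ≤ L`). [folklore] -/
theorem hubbardTermSupp_subset_far {i₀ : Fin d} {b : ℤ} {w : ℕ} (hw : 1 ≤ w) (hwL : 2 * w ≤ L)
    {Z : HubbardIdx (fermionTorusGraph d L)}
    (hZ : ¬ hubbardTermSupp (fermionTorusGraph d L) Z ⊆ slab i₀ (zIco L (b - w) (b + w))) :
    hubbardTermSupp (fermionTorusGraph d L) Z ⊆ slab i₀ (zIco L (b + w - 1) (b + L - w + 1)) := by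
  obtain ⟨y, hy, hyB⟩ := Finset.not_subset.1 hZ
  rw [mem_slab] at hyB
  have hw' : (1 : ℤ) ≤ w := by exact_mod_cast hw
  have hwL' : 2 * (w : ℤ) ≤ L := by exact_mod_cast hwL
  have hfar : coordZ i₀ y ∈ zIco L (b + w) (b - w + L) :=
    mem_zIco_of_not_mem (by linarith) (by linarith) hyB
  refine (hubbardTermSupp_subset_slab_of_mem hy hfar).trans (slab_mono i₀ (zIco_subset_zIco (by linarith) (by linarith)))

omit [NeZero L] in
/-- Terms meeting the window slab `[b-1, b]` are supported in `[b-2, b+1]`. [folklore] -/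
theorem hubbardTermSupp_subset_near {i₀ : Fin d} {b : ℤ} {Z : HubbardIdx (fermionTorusGraph d L)}
    (hZ : ¬ Disjoint (hubbardTermSupp (fermionTorusGraph d L) Z) (slab i₀ (zIco L (b - 1) (b + 1)))) :
    hubbardTermSupp (fermionTorusGraph d L) Z ⊆ slab i₀ (zIco L (b - 2) (b + 2)) := by
  obtain ⟨y, hy, hyW⟩ := Finset.not_disjoint_iff.1 hZ
  rw [mem_slab] at hyW
  refine (hubbardTermSupp_subset_slab_of_mem hy hyW).trans (slab_mono i₀ (zIco_subset_zIco (by linarith) (by linarith)))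

omit [NeZero L] in
/-- Terms meeting the far region `[b+w-1, b+L-w]` are supported in `[b+w-2, b+L-w+1]`. [folklore] -/
theorem hubbardTermSupp_subset_far' {i₀ : Fin d} {b : ℤ} {w : ℕ} {Z : HubbardIdx (fermionTorusGraph d L)}
    (hZ : ¬ Disjoint (hubbardTermSupp (fermionTorusGraph d L) Z) (slab i₀ (zIco L (b + w - 1) (b + L - w + 1)))) :
    hubbardTermSupp (fermionTorusGraph d L) Z ⊆ slab i₀ (zIco L (b + w - 2) (b + L - w + 2)) := by
  obtain ⟨y, hy, hyW⟩ := Finset.not_disjoint_iff.1 hZ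
  rw [mem_slab] at hyW
  refine (hubbardTermSupp_subset_slab_of_mem hy hyW).trans (slab_mono i₀ (zIco_subset_zIco (by linarith) (by linarith)))

omit [NeZero L] in
/-- The far region and the window are disjoint (`2 ≤ w`). [folklore] -/
theorem disjoint_far_window {b : ℤ} {w : ℕ} (hw : 2 ≤ w) :
    Disjoint (zIco L (b - 1) (b + 1)) (zIco L (b + w - 1) (b + L - w + 1)) := by
  have hw' : (2 : ℤ) ≤ w := by exact_mod_cast hw
  exact disjoint_zIco (by linarith) (by linarith)

/-- Periodic distance from the near region `[b-2, b+1]` to the far region `[b+w-1, b+L-w]` is at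
least `w - 2` (`3 ≤ w`, `2w ≤ L`). [folklore] -/
theorem le_circDist_near_far {b : ℤ} {w : ℕ} (hw : 3 ≤ w) (hwL : 2 * w ≤ L) :
    ∀ z ∈ zIco L (b - 2) (b + 2), ∀ z' ∈ zIco L (b + w - 1) (b + L - w + 1), w - 2 ≤ circDist z z' := by
  intro z hz z' hz'
  have hw' : (3 : ℤ) ≤ w := by exact_mod_cast hw
  have hwL' : 2 * (w : ℤ) ≤ L := by exact_mod_cast hwL
  have hcast : ((w - 2 : ℕ) : ℤ) = w - 2 := by push_cast [Nat.cast_sub (by omega : 2 ≤ w)]; ring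
  exact le_circDist_of_mem_zIco (by linarith) (by linarith) (by rw [hcast]; linarith) (by rw [hcast]; linarith) hz hz'

/-- Periodic distance from the window `[b-1, b]` to the enlarged far region `[b+w-2, b+L-w+1]` is
at least `w - 2` (`3 ≤ w`, `2w ≤ L`). [folklore] -/
theorem le_circDist_window_far' {b : ℤ} {w : ℕ} (hw : 3 ≤ w) (hwL : 2 * w ≤ L) :
    ∀ z ∈ zIco L (b - 1) (b + 1), ∀ z' ∈ zIco L (b + w - 2) (b + L - w + 2), w - 2 ≤ circDist z z' := by
  intro z hz z' hz'
  have hw' : (3 : ℤ) ≤ w := by exact_mod_cast hw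
  have hwL' : 2 * (w : ℤ) ≤ L := by exact_mod_cast hwL
  have hcast : ((w - 2 : ℕ) : ℤ) = w - 2 := by push_cast [Nat.cast_sub (by omega : 2 ≤ w)]; ring
  exact le_circDist_of_mem_zIco (by linarith) (by linarith) (by rw [hcast]; linarith) (by rw [hcast]; linarith) hz hz'

omit [NeZero L] in
/-- Periodic distances are symmetric in the two slabs. [folklore] -/
theorem le_circDist_symm {S T : Finset (ZMod L)} {r : ℕ} (h : ∀ z ∈ S, ∀ z' ∈ T, r ≤ circDist z z') :
    ∀ z' ∈ T, ∀ z ∈ S, r ≤ circDist z' z := fun z' hz' z hz => by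
  rw [circDist_comm]; exact h z hz z' hz'

end Geometry

/-! ### The Lieb–Robinson input and the locality of the dressing (pinned instances) -/

section Analysis

open FermionTorus

/-- Pinned instance (local to this section): the `DecidableEq` instance of the orbitals of the
torus derived from the linear order — the one carried by the generic CAR-algebra, Lieb–Robinson and
quasi-adiabatic lemmas — so that all operator-norm and spectral-gap expressions of this section are
syntactically theirs (cf. the design notes of `HubbardTorusCharges`, `HubbardLSMFillingAssembly`).
[folklore] -/
local instance (priority := high) instDecidableEqOrbFermionTorus {d L : ℕ} :
    DecidableEq (Orb (FermionTorus d L)) := LinearOrder.toDecidableEq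

/-- Pinned instance (local to this section): the `DecidableEq` instance of the sites of the torus
derived from the linear order (used by `Finset` operations on supports inside the generic
Lieb–Robinson bound). [folklore] -/
local instance (priority := high) instDecidableEqFermionTorus' {d L : ℕ} :
    DecidableEq (FermionTorus d L) := LinearOrder.toDecidableEq

variable {d L : ℕ} [NeZero L]

omit [NeZero L] in
/-- The `x_{i₀}`-coordinate is a coordinate function of the torus graph. [folklore] -/
theorem isCoordFn_coordZ (i₀ : Fin d) : IsCoordFn (coordZ (L := L) i₀) (fermionTorusGraph d L) :=
  fun _ _ h => coordZ_rel_of_adj i₀ h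

/-- The Lieb–Robinson rate `κ = e · 2J · 2(2Δ+1)` of the fermionic bound for the torus
(`J = 2|t| + |U| + 2|μ|`, `Δ = 2d`). [folklore] -/
def torusLRRate (d : ℕ) (t U μ : ℝ) : ℝ :=
  Real.exp 1 * (2 * (2 * |t| + |U| + 2 * |μ|) * (2 * (2 * (2 * d) + 1) : ℕ))

/-- `κ ≥ 0`. [folklore] -/
theorem torusLRRate_nonneg (d : ℕ) (t U μ : ℝ) : 0 ≤ torusLRRate d t U μ := by
  unfold torusLRRate; positivity

/-- A geometric sum bound: nonnegative terms indexed by a filter of `univ`, each at most `c`, add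
up to at most `|univ| c`. [folklore] -/
theorem sum_filter_le_card_mul {ι : Type*} [Fintype ι] (p : ι → Prop) [DecidablePred p] {f : ι → ℝ} {c : ℝ}
    (hc : 0 ≤ c) (hf : ∀ i, p i → f i ≤ c) :
    ∑ i ∈ Finset.univ.filter p, f i ≤ Fintype.card ι * c := by
  calc ∑ i ∈ Finset.univ.filter p, f i ≤ ∑ _i ∈ Finset.univ.filter p, c :=
        Finset.sum_le_sum fun i hi => hf i (Finset.mem_filter.1 hi).2
    _ = (Finset.univ.filter p).card * c := by rw [Finset.sum_const, nsmul_eq_mul]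
    _ ≤ Fintype.card ι * c := by
        refine mul_le_mul_of_nonneg_right ?_ hc
        exact_mod_cast Finset.card_le_univ _

/-- **The Lieb–Robinson input for the locality of the dressing (BBDF Prop. 2.4, via the fermionic
Lieb–Robinson bound).** Let `J` be an even observable of the window slab `{b-1 ≤ x_{i₀} ≤ b}` and
`A = H - H_{box}` the sum of the terms of `H(t,U) - μN` not supported in the box
`{b-w ≤ x_{i₀} ≤ b+w-1}` (`3 ≤ w`, `2w ≤ L`). Then for `|s| ≤ T`,
`‖[τ_s(A), J]‖ ≤ 4J · N_T · ‖A‖ ‖J‖ · T e^{κT - (w-2)}` (`N_T` the number of local terms): the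
terms of `A` are at `x_{i₀}`-distance `≥ w - 2` from the window, and both time directions are
covered by `‖[τ_{-s}(A), J]‖ = ‖[τ_s(J), A]‖`. [cite: BachmannEtAl2019, Prop. 2.4 (proof)] -/
theorem norm_commutator_evolution_far_le (i₀ : Fin d) (t U μ : ℝ) {b : ℤ} {w : ℕ} (hw : 3 ≤ w)
    (hwL : 2 * w ≤ L)
    {J : Matrix (Finset (Orb (FermionTorus d L))) (Finset (Orb (FermionTorus d L))) ℂ}
    (hJ : J ∈ carEvenSubalgebra (orbSet (slab i₀ (zIco L (b - 1) (b + 1)))))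
    {NT : ℕ} (hNT : Fintype.card (HubbardIdx (fermionTorusGraph d L)) ≤ NT)
    {T s : ℝ} (hT : 0 ≤ T) (hs : |s| ≤ T) :
    ‖heisenbergEvolution (hubbardTorusWith d L t U μ) s
        (hubbardTorusWith d L t U μ - localHubbard (fermionTorusGraph d L) t U μ (slab i₀ (zIco L (b - w) (b + w)))) * J -
      J * heisenbergEvolution (hubbardTorusWith d L t U μ) s
        (hubbardTorusWith d L t U μ - localHubbard (fermionTorusGraph d L) t U μ (slab i₀ (zIco L (b - w) (b + w))))‖ ≤
      4 * (2 * |t| + |U| + 2 * |μ|) * NT *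
        ‖hubbardTorusWith d L t U μ - localHubbard (fermionTorusGraph d L) t U μ (slab i₀ (zIco L (b - w) (b + w)))‖ *
        ‖J‖ * T * Real.exp (torusLRRate d t U μ * T - (w - 2 : ℕ)) := by
  set G := fermionTorusGraph d L with hG
  set H := hubbardTorusWith d L t U μ with hH
  set Jc : ℝ := 2 * |t| + |U| + 2 * |μ| with hJc
  have hNT' : (Fintype.card (HubbardIdx G) : ℝ) ≤ NT := by exact_mod_cast hNT
  set A := H - localHubbard G t U μ (slab i₀ (zIco L (b - w) (b + w))) with hA
  have hHG : H = hamiltonianWith G t U μ := rfl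
  have hHh : H.IsHermitian := by
    rw [hHG, ← sum_hubbardTermOp]
    exact isHermitian_finset_sum _ fun Z _ => isHermitian_hubbardTermOp G t U μ Z
  have hΔ : ∀ x : FermionTorus d L, (Finset.univ.filter fun y => G.Adj x y).card ≤ 2 * d :=
    fun x => card_filter_fermionTorusGraph_adj_le x
  have hw1 : 1 ≤ w := by omega
  have hw2 : 2 ≤ w := by omega
  -- the regions
  set Far := (slab i₀ (zIco L (b + w - 1) (b + L - w + 1)) : Finset (FermionTorus d L)) with hFar
  set Win := (slab i₀ (zIco L (b - 1) (b + 1)) : Finset (FermionTorus d L)) with hWin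
  have hwL' : 2 * (w : ℤ) ≤ L := by exact_mod_cast hwL
  have hw' : (3 : ℤ) ≤ w := by exact_mod_cast hw
  have hFar_ne : Far.Nonempty := slab_nonempty i₀ (zIco_nonempty (by linarith))
  have hWin_ne : Win.Nonempty := slab_nonempty i₀ (zIco_nonempty (by linarith))
  -- supports
  have hA_mem : A ∈ carEvenSubalgebra (orbSet Far) :=
    hamiltonianWith_sub_localHubbard_mem G t U μ _ Far fun Z hZ => hubbardTermSupp_subset_far hw1 hwL hZ
  have hA_mem' : A ∈ carSubalgebra (orbSet Far) := (carEvenSubalgebra_le_carSubalgebra _) hA_mem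
  have hJ' : J ∈ carSubalgebra (orbSet Win) := (carEvenSubalgebra_le_carSubalgebra _) hJ
  have hdisj : Disjoint (orbSet Far) (orbSet Win) :=
    disjoint_orbSet (disjoint_slab (disjoint_far_window (L := L) (b := b) hw2).symm)
  have hcommAJ : A * J - J * A = 0 := sub_eq_zero.2 (commute_of_mem_carEvenSubalgebra hA_mem hJ' hdisj).eq
  have hcommJA : J * A - A * J = 0 := sub_eq_zero.2 (commute_of_mem_carEvenSubalgebra hJ hA_mem' hdisj.symm).eq
  -- the common shape of the bound for `0 ≤ s' ≤ T`
  have hκ := torusLRRate_nonneg d t U μ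
  have hshape : ∀ s' : ℝ, 0 ≤ s' → s' ≤ T → ∀ ℓ : ℕ, w - 2 ≤ ℓ →
      s' * Real.exp (torusLRRate d t U μ * s' - ℓ) ≤ T * Real.exp (torusLRRate d t U μ * T - (w - 2 : ℕ)) := by
    intro s' hs0 hsT ℓ hℓ
    refine mul_le_mul hsT (Real.exp_le_exp.2 ?_) (Real.exp_pos _).le hT
    have : ((w - 2 : ℕ) : ℝ) ≤ ℓ := by exact_mod_cast hℓ
    nlinarith [mul_le_mul_of_nonneg_left hsT hκ]
  -- levels of the terms meeting `Far` (w.r.t. `Win`) and meeting `Win` (w.r.t. `Far`)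
  have hlevFar : ∀ Z : HubbardIdx G, ¬ Disjoint (hubbardTermSupp G Z) Far →
      w - 2 ≤ (hubbardTermSupp G Z).inf' (hubbardTermSupp_nonempty G Z) (clevel (coordZ i₀) Win hWin_ne) := by
    intro Z hZ
    refine Finset.le_inf' _ _ fun x hx => ?_
    have hsub := hubbardTermSupp_subset_far' (i₀ := i₀) (b := b) (w := w) hZ
    refine le_clevel (coordZ i₀) hWin_ne (X := slab i₀ (zIco L (b + w - 2) (b + L - w + 2))) ?_ (hsub hx)
    intro x' hx' y hy
    rw [mem_slab] at hx' hy
    rw [circDist_comm]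
    exact le_circDist_window_far' hw hwL _ hy _ hx'
  have hlevWin : ∀ Z : HubbardIdx G, ¬ Disjoint (hubbardTermSupp G Z) Win →
      w - 2 ≤ (hubbardTermSupp G Z).inf' (hubbardTermSupp_nonempty G Z) (clevel (coordZ i₀) Far hFar_ne) := by
    intro Z hZ
    refine Finset.le_inf' _ _ fun x hx => ?_
    have hsub := hubbardTermSupp_subset_near (i₀ := i₀) (b := b) hZ
    refine le_clevel (coordZ i₀) hFar_ne (X := slab i₀ (zIco L (b - 2) (b + 2))) ?_ (hsub hx)
    intro x' hx' y hy
    rw [mem_slab] at hx' hy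
    exact le_circDist_near_far hw hwL _ hx' _ hy
  -- Lipschitz property of the level functions
  have hLipWin : ∀ x y, G.Adj x y → clevel (coordZ i₀) Win hWin_ne x ≤ clevel (coordZ i₀) Win hWin_ne y + 1 :=
    fun x y h => clevel_le_of_adj (coordZ i₀) (isCoordFn_coordZ i₀) hWin_ne h
  have hLipFar : ∀ x y, G.Adj x y → clevel (coordZ i₀) Far hFar_ne x ≤ clevel (coordZ i₀) Far hFar_ne y + 1 :=
    fun x y h => clevel_le_of_adj (coordZ i₀) (isCoordFn_coordZ i₀) hFar_ne h
  have hposJc : 0 ≤ Jc := by positivity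
  rcases le_or_gt 0 s with hs0 | hs0
  · -- `s ≥ 0`: `A` evolves
    have hsT : s ≤ T := (le_abs_self s).trans hs
    have key := fermion_lieb_robinson_hamiltonianWith G hΔ t U μ hA_mem' hJ'
      (clevel (coordZ i₀) Win hWin_ne) (fun y hy => clevel_eq_zero (coordZ i₀) hWin_ne hy) hLipWin hs0
    rw [← hHG] at key
    rw [hcommAJ, norm_zero, zero_add] at key
    refine key.trans ?_
    have hsum : ∑ Z ∈ Finset.univ.filter (fun Z : HubbardIdx G => ¬ Disjoint (hubbardTermSupp G Z) Far),
        2 * (2 * |t| + |U| + 2 * |μ|) * ‖J‖ * s *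
          Real.exp (Real.exp 1 * (2 * (2 * |t| + |U| + 2 * |μ|) * (2 * (2 * (2 * d) + 1) : ℕ)) * s -
            ((hubbardTermSupp G Z).inf' (hubbardTermSupp_nonempty G Z) (clevel (coordZ i₀) Win hWin_ne) : ℕ)) ≤
        NT * (2 * Jc * ‖J‖ * (T * Real.exp (torusLRRate d t U μ * T - (w - 2 : ℕ)))) := by
      have hc0 : 0 ≤ 2 * Jc * ‖J‖ * (T * Real.exp (torusLRRate d t U μ * T - (w - 2 : ℕ))) := by positivity
      refine (sum_filter_le_card_mul _ hc0 fun Z hZ => ?_).trans (mul_le_mul_of_nonneg_right hNT' hc0)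
      have h1 := hshape s hs0 hsT _ (hlevFar Z hZ)
      rw [hJc]
      calc _ = 2 * (2 * |t| + |U| + 2 * |μ|) * ‖J‖ * (s * Real.exp (torusLRRate d t U μ * s -
            ((hubbardTermSupp G Z).inf' (hubbardTermSupp_nonempty G Z) (clevel (coordZ i₀) Win hWin_ne) : ℕ))) := by
            rw [torusLRRate]; ring
        _ ≤ 2 * (2 * |t| + |U| + 2 * |μ|) * ‖J‖ * (T * Real.exp (torusLRRate d t U μ * T - (w - 2 : ℕ))) :=
            mul_le_mul_of_nonneg_left h1 (by positivity)
    refine (mul_le_mul_of_nonneg_left hsum (by positivity)).trans (le_of_eq ?_)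
    ring
  · -- `s < 0`: `J` evolves
    have hs0' : 0 ≤ -s := by linarith
    have hsT : -s ≤ T := (neg_le_abs s).trans hs
    have e : s = -(-s) := by ring
    rw [e, norm_commutator_heisenbergEvolution_neg' hHh (-s) A J]
    have key := fermion_lieb_robinson_hamiltonianWith G hΔ t U μ hJ' hA_mem'
      (clevel (coordZ i₀) Far hFar_ne) (fun y hy => clevel_eq_zero (coordZ i₀) hFar_ne hy) hLipFar hs0'
    rw [← hHG] at key
    rw [hcommJA, norm_zero, zero_add] at key
    refine key.trans ?_
    have hsum : ∑ Z ∈ Finset.univ.filter (fun Z : HubbardIdx G => ¬ Disjoint (hubbardTermSupp G Z) Win),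
        2 * (2 * |t| + |U| + 2 * |μ|) * ‖A‖ * (-s) *
          Real.exp (Real.exp 1 * (2 * (2 * |t| + |U| + 2 * |μ|) * (2 * (2 * (2 * d) + 1) : ℕ)) * (-s) -
            ((hubbardTermSupp G Z).inf' (hubbardTermSupp_nonempty G Z) (clevel (coordZ i₀) Far hFar_ne) : ℕ)) ≤
        NT * (2 * Jc * ‖A‖ * (T * Real.exp (torusLRRate d t U μ * T - (w - 2 : ℕ)))) := by
      have hc0 : 0 ≤ 2 * Jc * ‖A‖ * (T * Real.exp (torusLRRate d t U μ * T - (w - 2 : ℕ))) := by positivity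
      refine (sum_filter_le_card_mul _ hc0 fun Z hZ => ?_).trans (mul_le_mul_of_nonneg_right hNT' hc0)
      have h1 := hshape (-s) hs0' hsT _ (hlevWin Z hZ)
      rw [hJc]
      calc _ = 2 * (2 * |t| + |U| + 2 * |μ|) * ‖A‖ * ((-s) * Real.exp (torusLRRate d t U μ * (-s) -
            ((hubbardTermSupp G Z).inf' (hubbardTermSupp_nonempty G Z) (clevel (coordZ i₀) Far hFar_ne) : ℕ))) := by
            rw [torusLRRate]; ring
        _ ≤ 2 * (2 * |t| + |U| + 2 * |μ|) * ‖A‖ * (T * Real.exp (torusLRRate d t U μ * T - (w - 2 : ℕ))) :=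
            mul_le_mul_of_nonneg_left h1 (by positivity)
    refine (mul_le_mul_of_nonneg_left hsum (by positivity)).trans (le_of_eq ?_)
    ring

/-- The torus Hubbard Hamiltonian is Hermitian. [folklore] -/
theorem isHermitian_hubbardTorusWith' (d L : ℕ) (t U μ : ℝ) : (hubbardTorusWith d L t U μ).IsHermitian := by
  change (hamiltonianWith (fermionTorusGraph d L) t U μ).IsHermitian
  rw [← sum_hubbardTermOp]
  exact isHermitian_finset_sum _ fun Z _ => isHermitian_hubbardTermOp _ t U μ Z

/-- **Locality of the quasi-adiabatic dressing on the torus (BBDF Prop. 2.4: the approximants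
`K± ∈ 𝒜_{∂±^{L/16}}` of `K̃± = i𝓘(J±)`).** For an even observable `J` of the window slab
`{b-1 ≤ x_{i₀} ≤ b}`, the generator computed with the Hamiltonian restricted to the box
`{b-w ≤ x_{i₀} ≤ b+w-1}` differs from the full one by at most
`η T ‖W₁‖₁/g + 4‖J‖ C_k/(g (1+gT)^{k+1})`, `η = 4J N_T ‖H - H_box‖ ‖J‖ T e^{κT-(w-2)}`, for every
`T ≥ 0` and `k` (`norm_qaGenerator_sub_qaGenerator_le_of_commutator` fed with
`norm_commutator_evolution_far_le`). [cite: BachmannEtAl2019, Prop. 2.4 (proof)] -/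
theorem norm_qaGenerator_sub_local_le (i₀ : Fin d) (t U μ : ℝ) {g : ℝ} (hg : 0 < g) {b : ℤ} {w : ℕ}
    (hw : 3 ≤ w) (hwL : 2 * w ≤ L)
    {J : Matrix (Finset (Orb (FermionTorus d L))) (Finset (Orb (FermionTorus d L))) ℂ}
    (hJ : J ∈ carEvenSubalgebra (orbSet (slab i₀ (zIco L (b - 1) (b + 1)))))
    {NT : ℕ} (hNT : Fintype.card (HubbardIdx (fermionTorusGraph d L)) ≤ NT) {T : ℝ} (hT : 0 ≤ T) (k : ℕ) :
    ‖qaGenerator g (hubbardTorusWith d L t U μ) J -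
        qaGenerator g (localHubbard (fermionTorusGraph d L) t U μ (slab i₀ (zIco L (b - w) (b + w)))) J‖ ≤
      (4 * (2 * |t| + |U| + 2 * |μ|) * NT *
          ‖hubbardTorusWith d L t U μ - localHubbard (fermionTorusGraph d L) t U μ (slab i₀ (zIco L (b - w) (b + w)))‖ *
          ‖J‖ * T * Real.exp (torusLRRate d t U μ * T - (w - 2 : ℕ))) * T * (qaWeightL1 / g) +
        2 * ‖J‖ * (2 * qaTailConst k / (g * (1 + g * T) ^ (k + 1))) := by
  have hH := isHermitian_hubbardTorusWith' d L t U μ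
  have hHloc := isHermitian_localHubbard (fermionTorusGraph d L) t U μ (slab i₀ (zIco L (b - w) (b + w)))
  refine norm_qaGenerator_sub_qaGenerator_le_of_commutator hH hHloc hg J hT (by positivity) (fun u hu => ?_) k
  exact norm_commutator_evolution_far_le i₀ t U μ hw hwL hJ hNT hT hu

/-- **The dressing operator at one boundary** (BBDF Prop. 2.4: `K = i𝓘^{H_box}(J)` for an
anti-Hermitian even boundary current `J`): it is Hermitian, even and supported in the box,
of norm `≤ (‖W₁‖₁/g)‖J‖`, and `(‖W₁‖₁/g)`-close… precisely within the bound of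
`norm_qaGenerator_sub_local_le` of the globally dressed `i𝓘^{H}(J)`. [cite: BachmannEtAl2019, Prop. 2.4] -/
theorem dressing_at_boundary (i₀ : Fin d) (t U μ : ℝ) {g : ℝ} (hg : 0 < g) {b : ℤ} {w : ℕ}
    (hw : 3 ≤ w) (hwL : 2 * w ≤ L)
    {J : Matrix (Finset (Orb (FermionTorus d L))) (Finset (Orb (FermionTorus d L))) ℂ}
    (hJ : J ∈ carEvenSubalgebra (orbSet (slab i₀ (zIco L (b - 1) (b + 1))))) (hJanti : Jᴴ = -J)
    {NT : ℕ} (hNT : Fintype.card (HubbardIdx (fermionTorusGraph d L)) ≤ NT) {T : ℝ} (hT : 0 ≤ T) (k : ℕ) :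
    (I • qaGenerator g (localHubbard (fermionTorusGraph d L) t U μ (slab i₀ (zIco L (b - w) (b + w)))) J).IsHermitian ∧
    I • qaGenerator g (localHubbard (fermionTorusGraph d L) t U μ (slab i₀ (zIco L (b - w) (b + w)))) J ∈
      carEvenSubalgebra (orbSet (slab i₀ (zIco L (b - w) (b + w)))) ∧
    ‖I • qaGenerator g (localHubbard (fermionTorusGraph d L) t U μ (slab i₀ (zIco L (b - w) (b + w)))) J‖ ≤
      qaWeightL1 / g * ‖J‖ ∧
    ‖I • qaGenerator g (hubbardTorusWith d L t U μ) J -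
        I • qaGenerator g (localHubbard (fermionTorusGraph d L) t U μ (slab i₀ (zIco L (b - w) (b + w)))) J‖ ≤
      (4 * (2 * |t| + |U| + 2 * |μ|) * NT *
          ‖hubbardTorusWith d L t U μ - localHubbard (fermionTorusGraph d L) t U μ (slab i₀ (zIco L (b - w) (b + w)))‖ *
          ‖J‖ * T * Real.exp (torusLRRate d t U μ * T - (w - 2 : ℕ))) * T * (qaWeightL1 / g) +
        2 * ‖J‖ * (2 * qaTailConst k / (g * (1 + g * T) ^ (k + 1))) := by
  set Hloc := localHubbard (fermionTorusGraph d L) t U μ (slab i₀ (zIco L (b - w) (b + w))) with hHloc_def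
  have hHloc := isHermitian_localHubbard (fermionTorusGraph d L) t U μ (slab i₀ (zIco L (b - w) (b + w)))
  have hw1 : (1 : ℤ) ≤ w := by exact_mod_cast (show 1 ≤ w by omega)
  have hJbox : J ∈ carEvenSubalgebra (orbSet (slab i₀ (zIco L (b - w) (b + w)))) :=
    carEvenSubalgebra_mono (orbSet_mono (slab_mono i₀ (zIco_subset_zIco (by linarith) (by linarith)))) hJ
  refine ⟨isHermitian_I_smul_qaGenerator hHloc hJanti g, ?_, ?_, ?_⟩
  · exact Subalgebra.smul_mem _ (qaGenerator_mem_subalgebra _ hHloc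
      (localHubbard_mem_carEvenSubalgebra _ t U μ _) hJbox g) _
  · rw [norm_I_smul]; exact norm_qaGenerator_le hHloc hg J
  · rw [← smul_sub, norm_I_smul]
    exact norm_qaGenerator_sub_local_le i₀ t U μ hg hw hwL hJ hNT hT k

omit [NeZero L] in
/-- Cyclic intervals of `CoordinateSlabs` are integer windows. [folklore] -/
theorem zrange_eq_zIco (a n : ℕ) : (zrange a n : Finset (ZMod L)) = zIco L a (a + n) := by
  ext z
  rw [mem_zrange, mem_zIco]
  constructor
  · rintro ⟨k, hk, rfl⟩
    exact ⟨(a + k : ℕ), by push_cast; linarith, by push_cast; linarith, by push_cast; rfl⟩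
  · rintro ⟨x, hax, hxb, rfl⟩
    refine ⟨(x - a).toNat, by omega, ?_⟩
    have hx : ((a + (x - a).toNat : ℕ) : ℤ) = x := by omega
    rw [← Int.cast_natCast (R := ZMod L) (a + (x - a).toNat), hx]

omit [NeZero L] in
/-- The slabs of `HubbardTorusCharges` are the coordinate slabs of `CoordinateSlabs` for `coordZ`. [folklore] -/
theorem slab_eq_cslab (i₀ : Fin d) (S : Finset (ZMod L)) :
    (slab i₀ S : Finset (FermionTorus d L)) = cslab (coordZ i₀) S := rfl

/-- The window `{L-1, L} = {-1, 0}` of coordinate values. [folklore] -/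
theorem zrange_pred_two : (zrange (L - 1) 2 : Finset (ZMod L)) = zIco L (-1) 1 := by
  have hL : 1 ≤ L := NeZero.pos L
  rw [zrange_eq_zIco]
  have e1 : ((L - 1 : ℕ) : ℤ) = -1 + L := by omega
  have e2 : ((L - 1 : ℕ) : ℤ) + (2 : ℕ) = 1 + L := by omega
  rw [e2, e1, zIco_add_period]

/-- Monotonicity of the locality bound in the two norms. [folklore] -/
theorem locality_bound_mono {c a a' j j' T E W D : ℝ} (hc : 0 ≤ c) (ha : 0 ≤ a) (haa : a ≤ a') (hj : 0 ≤ j)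
    (hjj : j ≤ j') (hT : 0 ≤ T) (hE : 0 ≤ E) (hW : 0 ≤ W) (hD : 0 ≤ D) :
    c * a * j * T * E * T * W + 2 * j * D ≤ c * a' * j' * T * E * T * W + 2 * j' * D := by
  have h1 : a * j ≤ a' * j' := mul_le_mul haa hjj hj (ha.trans haa)
  have h2 : c * a * j * T * E * T * W = (a * j) * (c * T * E * T * W) := by ring
  have h3 : c * a' * j' * T * E * T * W = (a' * j') * (c * T * E * T * W) := by ring
  rw [h2, h3]
  have h4 : 0 ≤ c * T * E * T * W := by positivity
  nlinarith [mul_le_mul_of_nonneg_right h1 h4, mul_le_mul_of_nonneg_right hjj hD]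

/-- **Local charge fluctuations of the gapped Hubbard torus at one volume (BBDF Proposition 2.4,
Assumption (iv)).** Let `ψ` be the normalised unique ground state of `H = H(t,U) - μN` on `ℤ_L^d`
with gap `g`, `Γ = {0 ≤ x_{i₀} < h}` the half-space slab (`2 ≤ h`, `h + 2 ≤ L`) and `3 ≤ w`,
`2w ≤ L`. The commutator `[Q^σ_Γ, H] = J₋ + J₊` splits into the boundary currents through the two
windows `{-1, 0}` and `{h-1, h}` (`crossing_zrange_subset`); `ψ` is an EXACT eigenvector of
`Q_Γ - i𝓘(J₋) - i𝓘(J₊)` (`qaGenerator_intertwines`, BBDF: "`[Q,P] - i[𝓘([Q,H]),P] = 0`"), and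
replacing the global dressings by the box dressings `K± = i𝓘^{H_box±}(J±)` (Hermitian, even,
supported in the boxes `[-w, w-1]`, `[h-w, h+w-1]`, `‖K₋‖ ≤ (‖W₁‖₁/g) 4J N_T`) costs at most twice the
locality bound of `dressing_at_boundary`. [cite: BachmannEtAl2019, Proposition 2.4] -/
theorem local_fluctuations_core (i₀ : Fin d) {t U μ g : ℝ} (hg : 0 < g)
    (hgap : (hubbardTorusWith d L t U μ).HasSpectralGap g)
    {ψ : Fock (Orb (FermionTorus d L))} (hψ : (hubbardTorusWith d L t U μ).IsGroundStateVector ψ)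
    (hψ1 : star ψ ⬝ᵥ ψ = 1) (σ : Fin 2) {w h : ℕ} (hw : 3 ≤ w) (hwL : 2 * w ≤ L) (hh : 2 ≤ h) (hhL : h + 2 ≤ L)
    {NT : ℕ} (hNT : Fintype.card (HubbardIdx (fermionTorusGraph d L)) ≤ NT) {T : ℝ} (hT : 0 ≤ T) (k : ℕ) :
    ∃ (Km Kp : Matrix (Finset (Orb (FermionTorus d L))) (Finset (Orb (FermionTorus d L))) ℂ) (q : ℝ),
      Km.IsHermitian ∧ Kp.IsHermitian ∧
      Km ∈ carEvenSubalgebra (orbSet (slab i₀ (zIco L (-(w : ℤ)) w))) ∧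
      Kp ∈ carEvenSubalgebra (orbSet (slab i₀ (zIco L ((h : ℤ) - w) (h + w)))) ∧
      ‖Km‖ ≤ qaWeightL1 / g * (NT * (4 * (2 * |t| + |U| + 2 * |μ|))) ∧
      eucNorm ((setCharge σ (slab i₀ (zIco L 0 h)) - Km - Kp) *ᵥ ψ - (q : ℂ) • ψ) ≤
        2 * ((4 * (2 * |t| + |U| + 2 * |μ|) * NT * (NT * (2 * |t| + |U| + 2 * |μ|)) *
              (NT * (4 * (2 * |t| + |U| + 2 * |μ|))) * T * Real.exp (torusLRRate d t U μ * T - (w - 2 : ℕ))) * T *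
              (qaWeightL1 / g) +
            2 * (NT * (4 * (2 * |t| + |U| + 2 * |μ|))) * (2 * qaTailConst k / (g * (1 + g * T) ^ (k + 1)))) := by
  set G := fermionTorusGraph d L with hG
  set H := hubbardTorusWith d L t U μ with hHdef
  set Jc : ℝ := 2 * |t| + |U| + 2 * |μ| with hJc
  have hHG : H = hamiltonianWith G t U μ := rfl
  have hH : H.IsHermitian := isHermitian_hubbardTorusWith' d L t U μ
  have hNT' : (Fintype.card (HubbardIdx G) : ℝ) ≤ NT := by exact_mod_cast hNT
  set Γ := (slab i₀ (zIco L 0 h) : Finset (FermionTorus d L)) with hΓ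
  set Q := setCharge σ Γ with hQ
  have hQh : Q.IsHermitian := isHermitian_setCharge σ Γ
  -- the boundary currents
  set S := crossing G Γ with hS
  set pm : HubbardIdx G → Prop := fun Z => hubbardTermSupp G Z ⊆ slab i₀ (zIco L (-1) 1) with hpm
  set C : HubbardIdx G → Matrix (Finset (Orb (FermionTorus d L))) (Finset (Orb (FermionTorus d L))) ℂ :=
    fun Z => Q * hubbardTermOp G t U μ Z - hubbardTermOp G t U μ Z * Q with hC
  set Jm := ∑ Z ∈ S.filter pm, C Z with hJm
  set Jp := ∑ Z ∈ S.filter (fun Z => ¬ pm Z), C Z with hJp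
  have hsplit : Q * H - H * Q = Jm + Jp := by
    rw [hHG, hQ, setCharge_commutator_hamiltonianWith, ← hQ, ← hS]
    exact (Finset.sum_filter_add_sum_filter_not S pm _).symm
  -- where the crossing terms live
  have hcross : ∀ Z ∈ S, hubbardTermSupp G Z ⊆ slab i₀ (zIco L (-1) 1) ∨
      hubbardTermSupp G Z ⊆ slab i₀ (zIco L ((h : ℤ) - 1) (h + 1)) := by
    intro Z hZ
    have hΓ' : Γ = cslab (coordZ i₀) (zrange 0 h) := by
      rw [hΓ, slab_eq_cslab, zrange_eq_zIco]; push_cast; ring_nf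
    rw [hS, hΓ'] at hZ
    have key := crossing_zrange_subset G (coordZ i₀) (isCoordFn_coordZ i₀) hh hhL Z hZ
    rw [zrange_pred_two, zrange_eq_zIco, ← slab_eq_cslab, ← slab_eq_cslab] at key
    have e : ((h - 1 : ℕ) : ℤ) + (2 : ℕ) = h + 1 := by omega
    have e' : ((h - 1 : ℕ) : ℤ) = h - 1 := by omega
    rw [e, e'] at key
    exact key
  have hSm : ∀ Z ∈ S.filter pm, hubbardTermSupp G Z ⊆ slab i₀ (zIco L (-1) 1) := fun Z hZ => (Finset.mem_filter.1 hZ).2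
  have hSp : ∀ Z ∈ S.filter (fun Z => ¬ pm Z), hubbardTermSupp G Z ⊆ slab i₀ (zIco L ((h : ℤ) - 1) (h + 1)) := by
    intro Z hZ
    obtain ⟨hZS, hZp⟩ := Finset.mem_filter.1 hZ
    exact (hcross Z hZS).resolve_left hZp
  -- properties of the currents
  have hJm_mem : Jm ∈ carEvenSubalgebra (orbSet (slab i₀ (zIco L ((0 : ℤ) - 1) (0 + 1)))) := by
    rw [zero_sub, zero_add]; exact sum_setCharge_commutator_mem G t U μ σ Γ _ _ hSm
  have hJp_mem : Jp ∈ carEvenSubalgebra (orbSet (slab i₀ (zIco L ((h : ℤ) - 1) (h + 1)))) :=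
    sum_setCharge_commutator_mem G t U μ σ Γ _ _ hSp
  have hJm_anti : Jmᴴ = -Jm := conjTranspose_sum_setCharge_commutator G t U μ σ Γ _
  have hJp_anti : Jpᴴ = -Jp := conjTranspose_sum_setCharge_commutator G t U μ σ Γ _
  have hcardm : ((S.filter pm).card : ℝ) ≤ NT := by
    refine le_trans ?_ hNT'
    exact_mod_cast (Finset.card_filter_le _ _).trans (Finset.card_le_univ _)
  have hcardp : ((S.filter fun Z => ¬ pm Z).card : ℝ) ≤ NT := by
    refine le_trans ?_ hNT'
    exact_mod_cast (Finset.card_filter_le _ _).trans (Finset.card_le_univ _)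
  have hJc0 : 0 ≤ Jc := by positivity
  have hJm_norm : ‖Jm‖ ≤ NT * (4 * Jc) :=
    (norm_sum_setCharge_commutator_le G t U μ σ Γ _).trans (mul_le_mul_of_nonneg_right hcardm (by positivity))
  have hJp_norm : ‖Jp‖ ≤ NT * (4 * Jc) :=
    (norm_sum_setCharge_commutator_le G t U μ σ Γ _).trans (mul_le_mul_of_nonneg_right hcardp (by positivity))
  -- the dressings
  obtain ⟨hKm_h, hKm_mem, hKm_norm, hKm_close⟩ := dressing_at_boundary i₀ t U μ hg (b := 0) hw hwL hJm_mem hJm_anti hNT hT k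
  obtain ⟨hKp_h, hKp_mem, hKp_norm, hKp_close⟩ := dressing_at_boundary i₀ t U μ hg (b := h) hw hwL hJp_mem hJp_anti hNT hT k
  simp only [zero_sub, zero_add] at hKm_h hKm_mem hKm_norm hKm_close
  set Km := I • qaGenerator g (localHubbard G t U μ (slab i₀ (zIco L (-(w : ℤ)) w))) Jm with hKm
  set Kp := I • qaGenerator g (localHubbard G t U μ (slab i₀ (zIco L ((h : ℤ) - w) (h + w)))) Jp with hKp
  set Ktm := I • qaGenerator g H Jm with hKtm
  set Ktp := I • qaGenerator g H Jp with hKtp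
  -- the exact eigenvector
  have hexact := qaGenerator_intertwines hH hg le_rfl hgap hψ hψ1 Q
  rw [hsplit, qaGenerator_add hH, smul_add] at hexact
  set M := Q - (Ktm + Ktp) with hM
  set c : ℂ := star ψ ⬝ᵥ (M *ᵥ ψ) with hc
  have hMh : M.IsHermitian := hQh.sub ((isHermitian_I_smul_qaGenerator hH hJm_anti g).add
    (isHermitian_I_smul_qaGenerator hH hJp_anti g))
  have hcre : c = ((c.re : ℝ) : ℂ) := expect_eq_re_of_isHermitian hMh ψ
  refine ⟨Km, Kp, c.re, hKm_h, hKp_h, hKm_mem, hKp_mem, ?_, ?_⟩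
  · exact hKm_norm.trans (mul_le_mul_of_nonneg_left hJm_norm (div_nonneg qaWeightL1_nonneg hg.le))
  · -- `(Q - Km - Kp)ψ - qψ = (K̃₋ - K₋)ψ + (K̃₊ - K₊)ψ`
    have hvec : (Q - Km - Kp) *ᵥ ψ - ((c.re : ℝ) : ℂ) • ψ = (Ktm - Km) *ᵥ ψ + (Ktp - Kp) *ᵥ ψ := by
      have e : Q - Km - Kp = M + ((Ktm - Km) + (Ktp - Kp)) := by rw [hM]; abel
      rw [← hcre, e, add_mulVec, hexact, add_mulVec]
      abel
    rw [hvec]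
    have hψn : eucNorm ψ = 1 := eucNorm_eq_one hψ1
    calc eucNorm ((Ktm - Km) *ᵥ ψ + (Ktp - Kp) *ᵥ ψ)
        ≤ eucNorm ((Ktm - Km) *ᵥ ψ) + eucNorm ((Ktp - Kp) *ᵥ ψ) := eucNorm_add_le _ _
      _ ≤ ‖Ktm - Km‖ * eucNorm ψ + ‖Ktp - Kp‖ * eucNorm ψ := add_le_add (eucNorm_mulVec_le _ _) (eucNorm_mulVec_le _ _)
      _ = ‖Ktm - Km‖ + ‖Ktp - Kp‖ := by rw [hψn, mul_one, mul_one]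
      _ ≤ _ := ?_
    -- the two locality bounds, made uniform
    have hA0 : ∀ B : Finset (FermionTorus d L), 0 ≤ ‖H - localHubbard G t U μ B‖ := fun B => norm_nonneg _
    have hAm : ‖H - localHubbard G t U μ (slab i₀ (zIco L (-(w : ℤ)) w))‖ ≤ NT * Jc :=
      (norm_hamiltonianWith_sub_localHubbard_le G t U μ _).trans (mul_le_mul_of_nonneg_right hNT' hJc0)
    have hAp : ‖H - localHubbard G t U μ (slab i₀ (zIco L ((h : ℤ) - w) (h + w)))‖ ≤ NT * Jc :=
      (norm_hamiltonianWith_sub_localHubbard_le G t U μ _).trans (mul_le_mul_of_nonneg_right hNT' hJc0)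
    have hE : 0 ≤ Real.exp (torusLRRate d t U μ * T - (w - 2 : ℕ)) := (Real.exp_pos _).le
    have hW : 0 ≤ qaWeightL1 / g := div_nonneg qaWeightL1_nonneg hg.le
    have hD : 0 ≤ 2 * qaTailConst k / (g * (1 + g * T) ^ (k + 1)) := by
      have := qaTailConst_pos k; positivity
    have h1 := hKm_close.trans (locality_bound_mono (c := 4 * Jc * NT) (by positivity) (hA0 _) hAm (norm_nonneg _)
      hJm_norm hT hE hW hD)
    have h2 := hKp_close.trans (locality_bound_mono (c := 4 * Jc * NT) (by positivity) (hA0 _) hAp (norm_nonneg _)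
      hJp_norm hT hE hW hD)
    linarith

/-- The fermionic torus has `L^d` sites. [folklore] -/
private theorem card_fermionTorus_eq (d L : ℕ) : Fintype.card (FermionTorus d L) = L ^ d := by
  change Fintype.card (Fin d → Fin L) = L ^ d
  rw [Fintype.card_fun, Fintype.card_fin, Fintype.card_fin]

/-- The number of local terms of the torus Hubbard Hamiltonian is at most `(2d+1) L^d`. [folklore] -/
theorem card_hubbardIdx_torus_le (d L : ℕ) [NeZero L] :
    Fintype.card (HubbardIdx (fermionTorusGraph d L)) ≤ (2 * d + 1) * L ^ d := by
  have h := card_hubbardIdx_le (fermionTorusGraph d L) (Δ := 2 * d) fun x => card_filter_fermionTorusGraph_adj_le x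
  rwa [card_fermionTorus_eq] at h

/-- `x^p e^{-cx} ≤ p!/c^p` for `x ≥ 0`, `c > 0`. [folklore] -/
private theorem pow_mul_exp_neg_le' {c : ℝ} (hc : 0 < c) (p : ℕ) {x : ℝ} (hx : 0 ≤ x) :
    x ^ p * Real.exp (-(c * x)) ≤ p.factorial / c ^ p := by
  have h := Real.pow_div_factorial_le_exp (c * x) (by positivity) p
  rw [div_le_iff₀ (by positivity : (0 : ℝ) < p.factorial)] at h
  have he := Real.exp_pos (c * x)
  rw [Real.exp_neg, le_div_iff₀ (pow_pos hc p)]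
  calc x ^ p * (Real.exp (c * x))⁻¹ * c ^ p = (c * x) ^ p * (Real.exp (c * x))⁻¹ := by
        rw [mul_pow]; ring
    _ ≤ (Real.exp (c * x) * p.factorial) * (Real.exp (c * x))⁻¹ :=
        mul_le_mul_of_nonneg_right h (inv_nonneg.2 he.le)
    _ = p.factorial := by field_simp

/-- **Local charge fluctuations of the gapped Hubbard torus, uniformly in the volume (BBDF
Proposition 2.4, Assumption (iv), in the quantitative `O(L^{-∞})` form).** For every `k'` there is a
constant `A` (depending on `d, t, U, μ, g, k'` only) such that for every `L ≥ 64`, direction `i₀`,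
spin `σ` and normalised unique ground state `ψ` of `H(t,U) - μN` on `ℤ_L^d` with gap `g`, there are
Hermitian even operators `K₋`, `K₊` supported within `L/16` of the two boundary hyperplanes of the
half-torus `Γ = {0 ≤ x_{i₀} < L/2}`, `‖K₋‖ ≤ A L^d`, and a real `q` with
`‖(Q^σ_Γ - K₋ - K₊)ψ - qψ‖₂ ≤ A L^{-k'}`: `local_fluctuations_core` with `w = L/16`, `h = L/2`,
`T = (w-2)/(2κ+1)` (so that `κT ≤ (w-2)/2`), `k = k' + d`, and the elementary bounds
`x^p e^{-cx} ≤ p!/c^p`, `(1 + gT)^{-(k+1)} ≤ (γ₁L)^{-(k+1)}`. (Statement with the pinned instances;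
see `local_fluctuations_hubbardTorus` for the form consumed by `bbdf2019_lsm_filling_of_inputs`.)
[cite: BachmannEtAl2019, Proposition 2.4] -/
theorem local_fluctuations_hubbardTorus_pinned (d : ℕ) (t U μ g : ℝ) (hg : 0 < g) (kK : ℕ) :
    ∃ AK : ℝ, 0 ≤ AK ∧ ∀ (L : ℕ) [NeZero L] (i₀ : Fin d) (σ : Fin 2) (ψ : Fock (Orb (FermionTorus d L))),
      64 ≤ L → (hubbardTorusWith d L t U μ).HasSpectralGap g →
      (hubbardTorusWith d L t U μ).IsGroundStateVector ψ → star ψ ⬝ᵥ ψ = 1 →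
      ∃ (Km Kp : Matrix (Finset (Orb (FermionTorus d L))) (Finset (Orb (FermionTorus d L))) ℂ) (q : ℝ),
        Km.IsHermitian ∧ Kp.IsHermitian ∧
        Km ∈ carEvenSubalgebra (orbSet (slab i₀ (zIco L (-((L / 16 : ℕ) : ℤ)) ((L / 16 : ℕ) + 1)))) ∧
        Kp ∈ carEvenSubalgebra (orbSet (slab i₀
          (zIco L (((L / 2 : ℕ) : ℤ) - 1 - (L / 16 : ℕ)) ((L / 2 : ℕ) + (L / 16 : ℕ))))) ∧
        ‖Km‖ ≤ AK * (L : ℝ) ^ d ∧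
        eucNorm ((setCharge σ (slab i₀ (zIco L 0 (L / 2 : ℕ))) - Km - Kp) *ᵥ ψ - (q : ℂ) • ψ) ≤
          AK / (L : ℝ) ^ kK := by
  -- constants (all depending on `d, t, U, μ, g, kK` only)
  have hJc0 : 0 ≤ 2 * |t| + |U| + 2 * |μ| := by positivity
  have hκ : 0 ≤ torusLRRate d t U μ := torusLRRate_nonneg d t U μ
  have hW : 0 ≤ qaWeightL1 := qaWeightL1_nonneg
  have hCk : 0 < qaTailConst (kK + d) := qaTailConst_pos _
  have hc₁0 : (0 : ℝ) < 1 / 128 := by norm_num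
  have hγ₁0 : 0 < g / (64 * (2 * torusLRRate d t U μ + 1)) := by positivity
  set KA : ℝ := 16 * (2 * |t| + |U| + 2 * |μ|) ^ 3 * (2 * d + 1 : ℝ) ^ 3 * (qaWeightL1 / g) *
    ((3 * d + 2 + kK).factorial / (1 / 128 : ℝ) ^ (3 * d + 2 + kK)) with hKA
  have hKA0 : 0 ≤ KA := by positivity
  set CB : ℝ := 16 * (2 * |t| + |U| + 2 * |μ|) * (2 * d + 1 : ℝ) * qaTailConst (kK + d) / g /
    (g / (64 * (2 * torusLRRate d t U μ + 1))) ^ (kK + d + 1) with hCB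
  have hCB0 : 0 ≤ CB := by positivity
  set AK : ℝ := 4 * qaWeightL1 * (2 * |t| + |U| + 2 * |μ|) * (2 * d + 1 : ℝ) / g + 2 * (KA + CB) with hAK
  have hAKnonneg : 0 ≤ AK := by positivity
  clear_value KA CB AK
  refine ⟨AK, hAKnonneg, ?_⟩
  intro L _ i₀ σ ψ hL hgap hψ hψ1
  -- scales
  set w : ℕ := L / 16 with hwdef
  set h : ℕ := L / 2 with hhdef
  have hw4 : 4 ≤ w := by omega
  have hw : 3 ≤ w := by omega
  have hwL : 2 * w ≤ L := by omega
  have hh : 2 ≤ h := by omega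
  have hhL : h + 2 ≤ L := by omega
  have hLw : L < 16 * w + 16 := by omega
  have hLr64 : (64 : ℝ) ≤ (L : ℝ) := by exact_mod_cast hL
  have hLr0 : (0 : ℝ) < (L : ℝ) := by linarith
  have hwr : (L : ℝ) / 16 - 1 ≤ (w : ℝ) := by
    have : (L : ℝ) < 16 * (w : ℝ) + 16 := by exact_mod_cast hLw
    linarith
  have hwr' : ((w - 2 : ℕ) : ℝ) = (w : ℝ) - 2 := by
    rw [Nat.cast_sub (by omega)]; norm_num
  have hw2pos : (0 : ℝ) ≤ (w : ℝ) - 2 := by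
    have : (4 : ℝ) ≤ w := by exact_mod_cast hw4
    linarith
  have hw2L : (L : ℝ) / 64 ≤ (w : ℝ) - 2 := by linarith
  have hwLr : (w : ℝ) - 2 ≤ (L : ℝ) := by
    have h2 : ((2 * w : ℕ) : ℝ) ≤ (L : ℝ) := by exact_mod_cast hwL
    push_cast at h2; linarith
  -- the time cutoff `T = (w - 2)/(2κ + 1)`
  have h2κ : 0 < 2 * torusLRRate d t U μ + 1 := by linarith
  set T : ℝ := ((w : ℝ) - 2) / (2 * torusLRRate d t U μ + 1) with hTdef
  have hT0 : 0 ≤ T := div_nonneg hw2pos h2κ.le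
  have hTw : T ≤ (w : ℝ) - 2 := div_le_self hw2pos (by linarith)
  have hTL : T ≤ (L : ℝ) := hTw.trans hwLr
  have hκT : torusLRRate d t U μ * T ≤ ((w : ℝ) - 2) / 2 := by
    rw [hTdef, mul_div_assoc', div_le_div_iff₀ h2κ (by norm_num : (0 : ℝ) < 2)]
    nlinarith
  have hTlow : (L : ℝ) / 64 / (2 * torusLRRate d t U μ + 1) ≤ T := by
    rw [hTdef]; exact div_le_div_of_nonneg_right hw2L h2κ.le
  -- the number of terms
  set NT : ℕ := (2 * d + 1) * L ^ d with hNTdef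
  have hNT : Fintype.card (HubbardIdx (fermionTorusGraph d L)) ≤ NT := card_hubbardIdx_torus_le d L
  have hNTr : (NT : ℝ) = (2 * d + 1 : ℝ) * (L : ℝ) ^ d := by rw [hNTdef]; push_cast; ring
  -- the core statement
  obtain ⟨Km, Kp, q, hKmh, hKph, hKm_mem, hKp_mem, hKmn, heps⟩ :=
    local_fluctuations_core i₀ hg hgap hψ hψ1 σ hw hwL hh hhL hNT hT0 (kK + d)
  have hw1 : (1 : ℤ) ≤ w := by exact_mod_cast (show 1 ≤ w by omega)
  refine ⟨Km, Kp, q, hKmh, hKph, ?_, ?_, ?_, ?_⟩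
  · exact carEvenSubalgebra_mono (orbSet_mono (slab_mono i₀ (zIco_subset_zIco le_rfl (by linarith)))) hKm_mem
  · exact carEvenSubalgebra_mono (orbSet_mono (slab_mono i₀ (zIco_subset_zIco (by linarith) le_rfl))) hKp_mem
  · -- `‖K₋‖ ≤ (W/g) NT 4Jc = (4 W Jc (2d+1) / g) L^d ≤ AK L^d`
    refine hKmn.trans ?_
    clear hKmn heps hKm_mem hKp_mem hKmh hKph hgap hψ hψ1
    have e : qaWeightL1 / g * (NT * (4 * (2 * |t| + |U| + 2 * |μ|))) =
        4 * qaWeightL1 * (2 * |t| + |U| + 2 * |μ|) * (2 * d + 1 : ℝ) / g * (L : ℝ) ^ d := by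
      rw [hNTr]; ring
    rw [e]
    refine mul_le_mul_of_nonneg_right ?_ (by positivity)
    rw [hAK]
    linarith [mul_nonneg (by norm_num : (0 : ℝ) ≤ 2) (add_nonneg hKA0 hCB0)]
  · -- the `O(L^{-∞})` bound
    refine heps.trans ?_
    clear hKmn heps hKm_mem hKp_mem hKmh hKph hgap hψ hψ1
    have hLk : (0 : ℝ) < (L : ℝ) ^ kK := by positivity
    -- term A: `16 Jc³ NT³ (W/g) T² e^{κT-(w-2)} ≤ KA / L^kK`
    have hE : Real.exp (torusLRRate d t U μ * T - (w - 2 : ℕ)) ≤ Real.exp (-(1 / 128 * (L : ℝ))) := by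
      refine Real.exp_le_exp.2 ?_
      rw [hwr']
      linarith
    have hA : (4 * (2 * |t| + |U| + 2 * |μ|) * NT * (NT * (2 * |t| + |U| + 2 * |μ|)) *
          (NT * (4 * (2 * |t| + |U| + 2 * |μ|))) * T * Real.exp (torusLRRate d t U μ * T - (w - 2 : ℕ))) * T *
          (qaWeightL1 / g) ≤ KA / (L : ℝ) ^ kK := by
      set CA : ℝ := 16 * (2 * |t| + |U| + 2 * |μ|) ^ 3 * (2 * d + 1 : ℝ) ^ 3 * (qaWeightL1 / g) with hCA
      have hCA0 : 0 ≤ CA := by positivity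
      have e1 : (4 * (2 * |t| + |U| + 2 * |μ|) * NT * (NT * (2 * |t| + |U| + 2 * |μ|)) *
          (NT * (4 * (2 * |t| + |U| + 2 * |μ|))) * T * Real.exp (torusLRRate d t U μ * T - (w - 2 : ℕ))) * T *
          (qaWeightL1 / g) = CA * ((L : ℝ) ^ d) ^ 3 * T ^ 2 * Real.exp (torusLRRate d t U μ * T - (w - 2 : ℕ)) := by
        rw [hCA, hNTr]; ring
      rw [e1]
      have h1 : T ^ 2 ≤ (L : ℝ) ^ 2 := pow_le_pow_left₀ hT0 hTL 2
      have h2 : CA * ((L : ℝ) ^ d) ^ 3 * T ^ 2 * Real.exp (torusLRRate d t U μ * T - (w - 2 : ℕ)) ≤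
          CA * ((L : ℝ) ^ d) ^ 3 * (L : ℝ) ^ 2 * Real.exp (-(1 / 128 * (L : ℝ))) :=
        mul_le_mul (mul_le_mul_of_nonneg_left h1 (by positivity)) hE (Real.exp_pos _).le (by positivity)
      refine h2.trans ?_
      rw [le_div_iff₀ hLk]
      have h3 : (L : ℝ) ^ (3 * d + 2 + kK) * Real.exp (-(1 / 128 * (L : ℝ))) ≤
          (3 * d + 2 + kK).factorial / (1 / 128 : ℝ) ^ (3 * d + 2 + kK) := pow_mul_exp_neg_le' hc₁0 _ hLr0.le
      have e2 : CA * ((L : ℝ) ^ d) ^ 3 * (L : ℝ) ^ 2 * Real.exp (-(1 / 128 * (L : ℝ))) * (L : ℝ) ^ kK =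
          CA * ((L : ℝ) ^ (3 * d + 2 + kK) * Real.exp (-(1 / 128 * (L : ℝ)))) := by
        rw [← pow_mul, pow_add, pow_add]; ring
      rw [e2]
      calc CA * ((L : ℝ) ^ (3 * d + 2 + kK) * Real.exp (-(1 / 128 * (L : ℝ))))
          ≤ CA * ((3 * d + 2 + kK).factorial / (1 / 128 : ℝ) ^ (3 * d + 2 + kK)) := mul_le_mul_of_nonneg_left h3 hCA0
        _ = KA := by rw [hKA, hCA]
    -- term B: `16 Jc NT C_k / (g (1+gT)^{k+1}) ≤ CB / L^kK`
    have hB : 2 * (NT * (4 * (2 * |t| + |U| + 2 * |μ|))) * (2 * qaTailConst (kK + d) / (g * (1 + g * T) ^ (kK + d + 1))) ≤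
        CB / (L : ℝ) ^ kK := by
      set γ₁ : ℝ := g / (64 * (2 * torusLRRate d t U μ + 1)) with hγ₁
      have hgT : γ₁ * (L : ℝ) ≤ g * T := by
        calc γ₁ * (L : ℝ) = g * ((L : ℝ) / 64 / (2 * torusLRRate d t U μ + 1)) := by rw [hγ₁]; field_simp
          _ ≤ g * T := mul_le_mul_of_nonneg_left hTlow hg.le
      have hγL : 0 < γ₁ * (L : ℝ) := by positivity
      have hpow : (γ₁ * (L : ℝ)) ^ (kK + d + 1) ≤ (1 + g * T) ^ (kK + d + 1) :=
        pow_le_pow_left₀ hγL.le (by linarith) _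
      have hpow0 : 0 < (γ₁ * (L : ℝ)) ^ (kK + d + 1) := by positivity
      -- `NT / (1+gT)^{k+1} ≤ NT / (γ₁ L)^{k+1}`
      have h1 : 2 * qaTailConst (kK + d) / (g * (1 + g * T) ^ (kK + d + 1)) ≤
          2 * qaTailConst (kK + d) / (g * (γ₁ * (L : ℝ)) ^ (kK + d + 1)) := by
        refine div_le_div_of_nonneg_left (by positivity) (by positivity) ?_
        exact mul_le_mul_of_nonneg_left hpow hg.le
      have h2 : 2 * (NT * (4 * (2 * |t| + |U| + 2 * |μ|))) * (2 * qaTailConst (kK + d) / (g * (1 + g * T) ^ (kK + d + 1))) ≤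
          2 * (NT * (4 * (2 * |t| + |U| + 2 * |μ|))) * (2 * qaTailConst (kK + d) / (g * (γ₁ * (L : ℝ)) ^ (kK + d + 1))) :=
        mul_le_mul_of_nonneg_left h1 (by positivity)
      refine h2.trans ?_
      have hL0 : (L : ℝ) ≠ 0 := hLr0.ne'
      have hg0 : g ≠ 0 := hg.ne'
      have hγ0 : γ₁ ≠ 0 := hγ₁0.ne'
      have e3 : 2 * (NT * (4 * (2 * |t| + |U| + 2 * |μ|))) * (2 * qaTailConst (kK + d) / (g * (γ₁ * (L : ℝ)) ^ (kK + d + 1))) =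
          CB / (L : ℝ) ^ (kK + 1) := by
        rw [hNTr, hCB, mul_pow]
        field_simp
        ring
      rw [e3]
      exact div_le_div_of_nonneg_left hCB0 hLk (pow_le_pow_right₀ (by linarith) (Nat.le_succ kK))
    have hsum := add_le_add hA hB
    have e : AK / (L : ℝ) ^ kK = (4 * qaWeightL1 * (2 * |t| + |U| + 2 * |μ|) * (2 * d + 1 : ℝ) / g) / (L : ℝ) ^ kK +
        2 * (KA / (L : ℝ) ^ kK + CB / (L : ℝ) ^ kK) := by
      rw [hAK]; ring
    rw [e]
    have hfirst : 0 ≤ (4 * qaWeightL1 * (2 * |t| + |U| + 2 * |μ|) * (2 * d + 1 : ℝ) / g) / (L : ℝ) ^ kK := by positivity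
    linarith

end Analysis

/-! ### The local charge fluctuation input of the assembly, and the fact modulo clustering -/

section Unpinned

open FermionTorus

/-- **Local charge fluctuations of the gapped Hubbard torus (BBDF Proposition 2.4, Assumption
(iv)), in the form consumed by `bbdf2019_lsm_filling_of_inputs`** (statement with the ambient
instances of the torus; it is `local_fluctuations_hubbardTorus_pinned` transported along the
definitional equality of the two `DecidableEq` instance paths, which the operator norm and the
spectral gap depend on only syntactically). [cite: BachmannEtAl2019, Proposition 2.4] -/
theorem local_fluctuations_hubbardTorus (d : ℕ) (t U μ g : ℝ) (hg : 0 < g) (kK : ℕ) :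
    ∃ AK : ℝ, 0 ≤ AK ∧ ∀ (L : ℕ) [NeZero L] (i₀ : Fin d) (σ : Fin 2) (ψ : Fock (Orb (FermionTorus d L))),
      64 ≤ L → (hubbardTorusWith d L t U μ).HasSpectralGap g →
      (hubbardTorusWith d L t U μ).IsGroundStateVector ψ → star ψ ⬝ᵥ ψ = 1 →
      ∃ (Km Kp : Matrix (Finset (Orb (FermionTorus d L))) (Finset (Orb (FermionTorus d L))) ℂ) (q : ℝ),
        Km.IsHermitian ∧ Kp.IsHermitian ∧
        Km ∈ carEvenSubalgebra (orbSet (slab i₀ (zIco L (-((L / 16 : ℕ) : ℤ)) ((L / 16 : ℕ) + 1)))) ∧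
        Kp ∈ carEvenSubalgebra (orbSet (slab i₀
          (zIco L (((L / 2 : ℕ) : ℤ) - 1 - (L / 16 : ℕ)) ((L / 2 : ℕ) + (L / 16 : ℕ))))) ∧
        ‖Km‖ ≤ AK * (L : ℝ) ^ d ∧
        eucNorm ((setCharge σ (slab i₀ (zIco L 0 (L / 2 : ℕ))) - Km - Kp) *ᵥ ψ - (q : ℂ) • ψ) ≤
          AK / (L : ℝ) ^ kK := by
  obtain ⟨AK, hAK, H⟩ := local_fluctuations_hubbardTorus_pinned d t U μ g hg kK
  refine ⟨AK, hAK, fun L _ i₀ σ ψ hL hgap hψ hψ1 => ?_⟩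
  -- pin the instances of the analysis section; hypotheses and conclusions are transported with
  -- `convert` (the two `DecidableEq` instances are propositionally equal by `Subsingleton.elim`)
  letI : DecidableEq (Orb (FermionTorus d L)) := instDecidableEqOrbFermionTorus
  letI : DecidableEq (FermionTorus d L) := instDecidableEqFermionTorus'
  have hgap' : (hubbardTorusWith d L t U μ).HasSpectralGap g := by convert hgap
  have hψ' : (hubbardTorusWith d L t U μ).IsGroundStateVector ψ := by convert hψ
  obtain ⟨Km, Kp, q, h1, h2, h3, h4, h5, h6⟩ := H L i₀ σ ψ hL hgap' hψ' hψ1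
  refine ⟨Km, Kp, q, h1, h2, h3, h4, ?_, h6⟩
  convert h5 using 4

/-- **The BBDF filling constraint for the Hubbard torus, modulo clustering.** The named fact
`bbdf2019_lsm_filling_hubbardTorus` follows from exponential clustering of the unique gapped ground
states in the `x₁`-direction (BBDF Assumption (v); Hastings–Koma / Nachtergaele–Sims, cited by
BBDF Prop. 2.4) alone: the local charge fluctuations (Assumption (iv)) are
`local_fluctuations_hubbardTorus`. [cite: BachmannEtAl2019, Theorem 2.1, Proposition 2.4, §3.2] -/
theorem bbdf2019_lsm_filling_of_clustering
    (hclus : ∀ (d : ℕ) (t U μ g : ℝ), 0 < g → ∃ Ccl ξ : ℝ, ∃ r₀ : ℕ, 0 < ξ ∧ 0 ≤ Ccl ∧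
      ∀ (L : ℕ) [NeZero L] (i₀ : Fin d) (ψ : Fock (Orb (FermionTorus d L))),
        (hubbardTorusWith d L t U μ).HasSpectralGap g →
        (hubbardTorusWith d L t U μ).IsGroundStateVector ψ → star ψ ⬝ᵥ ψ = 1 →
        ∀ (S₁ S₂ : Finset (ZMod L)) (r : ℕ), r₀ ≤ r → (∀ z ∈ S₁, ∀ z' ∈ S₂, r ≤ circDist z z') →
        ∀ A ∈ carEvenSubalgebra (orbSet (slab i₀ S₁)), ∀ B ∈ carEvenSubalgebra (orbSet (slab i₀ S₂)),
          ‖star ψ ⬝ᵥ ((A * B) *ᵥ ψ) - (star ψ ⬝ᵥ (A *ᵥ ψ)) * (star ψ ⬝ᵥ (B *ᵥ ψ))‖ ≤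
            Ccl * (L : ℝ) ^ d * ‖A‖ * ‖B‖ * Real.exp (-(r : ℝ) / ξ)) :
    bbdf2019_lsm_filling_hubbardTorus :=
  bbdf2019_lsm_filling_of_inputs hclus fun d t U μ g hg kK => local_fluctuations_hubbardTorus d t U μ g hg kK

end Unpinned

end Literature.MathematicalPhysics.QuantumLattice

end
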